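import Summits.AtomisticToContinuum.BoseEinsteinCondensation.Theorems.FibreConductance.Negative.FreeConstantFlow
import Summits.AtomisticToContinuum.BoseEinsteinCondensation.Theorems.InfraredMinimumUncertainty.Negative.FreeMinimisersConstant

/-!
# Route `BECThomsonPrinciple`, crux `FibreConductance` (stmt-AtomisticToContinuum-9480):
# the FREE CASE of the crux holds for EVERY admissible datum

Supports (does not close) stmt-AtomisticToContinuum-9480.  The crux `FibreConductance`
(`Theses/BECThomsonPrinciple.lean`) quantifies over bounded repulsive finite-range `v`; its free
member `v ≡ 0` is the one case in which the exact-minimiser hypothesis (H1) is fully under control,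
and here it is discharged for ALL data, not only for the hand-picked constant state:

* `fibreW_congr_norm`, `fibrePsi_congr_norm`, `fibreBeta_congr_norm`, `fibreCharge_congr_norm`,
  `fibreCost_congr_norm`, `fibreBoundAt_congr_norm` — the crux's fibre data `W, ψ, β, q`, its cost
  and its conclusion at one datum depend on the wave function only through `X ↦ ‖Φ X‖` (they are
  built from `‖Φ(y, X̂)‖`), so they transfer along any two states with the same modulus;
* `norm_eq_of_free_minimiser` — an exact minimiser of the FREE periodic energy is a constant of
  modulus `L^{-3N/2}` (`exists_eq_const_of_free_minimiser`: zero kinetic energy forces a constant,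
  and the normalisation fixes its modulus), i.e. it has the modulus of the constant state;
* `fibreBoundAt_of_free_minimiser` — hence the crux's conclusion holds at `v = 0` for EVERY exact
  minimiser and every mode `n ≠ 0` with the constant `1/4π²` (transfer of
  `fibreBoundAt_constState`, the canonical flow `-i(k_l/|k|²)L⁻³e_n(x₀)` of cost exactly
  `L²/(4π²|n|₂²)`);
* `fibreConductanceWith_zero`, `fibreConductance_freeCase` — the crux's statement with `v`
  specialised to `0`, for every `ρ₀`, `N₀`, `M` (no density, window or size restriction is needed
  at `v = 0`).  With the floor `fibreConductanceWith_zero_const_ge` (`C ≥ 1/4π²` at `v = 0`,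
  `Negative/FreeFloor`) the free value of the crux's constant is pinned from both sides on the whole
  admissible class.

This closes attack surface (i) (§G3) of the crux disprover's standing file
`Cruxes/FibreConductance/Disproof.lean` on the positive side: the degenerate member `v ≡ 0` of the
admissible class is not a counterexample for any admissible `Φ`.  All [folklore].
-/

noncomputable section

namespace Summit.AtomisticToContinuum.BoseEinsteinCondensation.Cruxes.FibreConductance.FreeCase

open MeasureTheory Real Literature.MathematicalPhysics.QuantumManyBody.BoseGas
open scoped ENNReal NNReal
open Summit.AtomisticToContinuum.BoseEinsteinCondensation.Theorems.FibreConductance.Negative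
open Summit.AtomisticToContinuum.BoseEinsteinCondensation.Theorems.GaussianDominationCan.Negative
  (constState)
open Summit.AtomisticToContinuum.BoseEinsteinCondensation.Theorems.InfraredMinimumUncertainty.Negative
  (exists_eq_const_of_free_minimiser)

variable {m : ℕ} {L : ℝ} {n : Fin 3 → ℤ}

/-! ### The fibre data depend on the state only through its modulus -/

section Congr

variable {φ φ' : Config (m + 1) → ℂ}

/-- `W` depends on `Φ` only through `‖Φ‖`. [folklore] -/
theorem fibreW_congr_norm (h : ∀ X, ‖φ X‖ = ‖φ' X‖) : fibreW L φ = fibreW L φ' := by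
  funext X
  unfold fibreW
  simp_rw [h]

/-- `ψ = ‖Φ‖/√W` depends on `Φ` only through `‖Φ‖`. [folklore] -/
theorem fibrePsi_congr_norm (h : ∀ X, ‖φ X‖ = ‖φ' X‖) : fibrePsi L φ = fibrePsi L φ' := by
  funext X
  unfold fibrePsi
  rw [h, fibreW_congr_norm h]

/-- `β` depends on `Φ` only through `‖Φ‖`. [folklore] -/
theorem fibreBeta_congr_norm (h : ∀ X, ‖φ X‖ = ‖φ' X‖) (n : Fin 3 → ℤ) :
    fibreBeta L n φ = fibreBeta L n φ' := by
  funext X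
  unfold fibreBeta
  rw [fibrePsi_congr_norm h]

/-- The fibre charge `q` depends on `Φ` only through `‖Φ‖`. [folklore] -/
theorem fibreCharge_congr_norm (h : ∀ X, ‖φ X‖ = ‖φ' X‖) (n : Fin 3 → ℤ) :
    fibreCharge L n φ = fibreCharge L n φ' := by
  funext X
  unfold fibreCharge
  rw [fibrePsi_congr_norm h, fibreBeta_congr_norm h]

/-- The Thomson cost `∫|J|²W/ψ²` depends on `Φ` only through `‖Φ‖`. [folklore] -/
theorem fibreCost_congr_norm (h : ∀ X, ‖φ X‖ = ‖φ' X‖) (J : Config (m + 1) → Fin 3 → ℂ) :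
    fibreCost L φ J = fibreCost L φ' J := by
  unfold fibreCost
  rw [fibreW_congr_norm h, fibrePsi_congr_norm h]

end Congr

/-- **The crux's conclusion at one datum transfers along equal moduli**: if `‖Φ X‖ = ‖Φ' X‖` for all
`X`, then `FibreBoundAt L n Φ C ↔ FibreBoundAt L n Φ' C` (same flow `J`). [folklore] -/
theorem fibreBoundAt_congr_norm {Φ Φ' : PeriodicTrialState (m + 1) L} (h : ∀ X, ‖Φ.ψ X‖ = ‖Φ'.ψ X‖)
    {C : ℝ} : FibreBoundAt L n Φ C ↔ FibreBoundAt L n Φ' C := by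
  unfold FibreBoundAt
  rw [fibreCharge_congr_norm h n]
  simp_rw [fibreCost_congr_norm h]

/-! ### Free exact minimisers have the modulus of the constant state -/

/-- The side constant `c_L = (√(L³))⁻¹` satisfies `c_L² L³ = 1`. [folklore] -/
theorem sideConst_sq_mul (hL : 0 < L) : ((Real.sqrt (L ^ 3))⁻¹) ^ 2 * L ^ 3 = 1 := by
  have hL3 : 0 < L ^ 3 := by positivity
  rw [inv_pow, Real.sq_sqrt hL3.le, inv_mul_cancel₀ hL3.ne']

/-- The modulus of the constant state: `‖Φ_c(X)‖ = c^{N}`. [folklore] -/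
theorem norm_constState (hL : 0 < L) {c : ℝ} (hc0 : 0 < c) (hc : c ^ 2 * L ^ 3 = 1)
    (X : Config (m + 1)) : ‖(constState m hL c hc).ψ X‖ = c ^ (m + 1) := by
  rw [constState_ψ_eq_realProd hL hc, norm_realProd (fun _ => hc0) X, Finset.prod_const,
    Finset.card_univ, Fintype.card_fin]

/-- **An exact minimiser of the free periodic energy is a constant of modulus `L^{-3N/2}`**:
`‖Φ(X)‖ = ((√(L³))⁻¹)^{N}` for every `X` (zero kinetic energy forces a constant —
`exists_eq_const_of_free_minimiser` — and `∫_{cell^N}|Φ|² = 1` fixes its modulus). [folklore] -/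
theorem norm_eq_of_free_minimiser (hL : 0 < L) (Φ : PeriodicTrialState (m + 1) L)
    (hE : periodicEnergy 0 Φ = periodicGroundStateEnergy 0 (m + 1) L) (X : Config (m + 1)) :
    ‖Φ.ψ X‖ = ((Real.sqrt (L ^ 3))⁻¹) ^ (m + 1) := by
  obtain ⟨c, hc⟩ := exists_eq_const_of_free_minimiser hL Φ hE
  have hL3 : 0 < L ^ 3 := by positivity
  -- the normalisation: `‖c‖² (L³)^N = 1`
  have hnorm := Φ.norm_eq
  simp_rw [hc] at hnorm
  rw [setLIntegral_cellN_const' hL.le, ← ENNReal.coe_pow, ← ENNReal.ofReal_coe_nnreal,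
    ← ENNReal.ofReal_mul (by positivity), ENNReal.ofReal_eq_one] at hnorm
  simp only [NNReal.coe_pow, coe_nnnorm] at hnorm
  -- the target constant has the same square
  set r : ℝ := (Real.sqrt (L ^ 3))⁻¹ with hr
  have hr0 : 0 < r := inv_pos.2 (Real.sqrt_pos.2 hL3)
  have hr2 : (r ^ (m + 1)) ^ 2 * (L ^ 3) ^ (m + 1) = 1 := by
    rw [← pow_mul, mul_comm (m + 1) 2, pow_mul, ← mul_pow, sideConst_sq_mul hL, one_pow]
  -- two nonnegative reals with the same positive multiple of their squares coincide
  have hK : 0 < (L ^ 3) ^ (m + 1) := by positivity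
  have hsq : ‖c‖ ^ 2 = (r ^ (m + 1)) ^ 2 := by
    have h1 : ‖c‖ ^ 2 = ((L ^ 3) ^ (m + 1))⁻¹ := eq_inv_of_mul_eq_one_left hnorm
    have h2 : (r ^ (m + 1)) ^ 2 = ((L ^ 3) ^ (m + 1))⁻¹ := eq_inv_of_mul_eq_one_left hr2
    rw [h1, h2]
  rw [hc]
  have habs := (sq_eq_sq₀ (norm_nonneg c) (pow_nonneg hr0.le (m + 1))).1 hsq
  exact habs

/-! ### The free case of the crux -/

/-- **The crux's conclusion at `v = 0`, for EVERY exact minimiser.** For every side `L > 0`, every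
mode `n ≠ 0` and every exact minimiser `Φ` of the free periodic energy (no zero-freeness, density or
window hypothesis is needed), there is a fibre flow with the crux's weak divergence and cost
`≤ (1/4π²) L²/‖n‖²`: the canonical flow of `fibreBoundAt_constState`, transferred along the equality
of moduli `‖Φ‖ = ‖Φ_const‖`. [folklore] -/
theorem fibreBoundAt_of_free_minimiser (hL : 0 < L) (hn : n ≠ 0) (Φ : PeriodicTrialState (m + 1) L)
    (hE : periodicEnergy 0 Φ = periodicGroundStateEnergy 0 (m + 1) L) :
    FibreBoundAt L n Φ (1 / (4 * π ^ 2)) := by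
  have hL3 : 0 < L ^ 3 := by positivity
  have hc := sideConst_sq_mul hL
  have hc0 : 0 < (Real.sqrt (L ^ 3))⁻¹ := inv_pos.2 (Real.sqrt_pos.2 hL3)
  have hmod : ∀ X, ‖Φ.ψ X‖ = ‖(constState m hL _ hc).ψ X‖ := fun X => by
    rw [norm_eq_of_free_minimiser hL Φ hE X, norm_constState hL hc0 hc X]
  exact (fibreBoundAt_congr_norm hmod).2 (fibreBoundAt_constState hL hn rfl hc)

/-- **`FibreConductanceWith ρ₀ (1/4π²) N₀ 0 M` for all `ρ₀, N₀, M`**: at `v = 0` the crux's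
conclusion holds with the (optimal, by `fibreConductanceWith_zero_const_ge`) constant `1/4π²` on the
whole admissible class, uniformly in every parameter. [folklore] -/
theorem fibreConductanceWith_zero (ρ₀ M : ℝ) (N₀ : ℕ) :
    FibreConductanceWith ρ₀ (1 / (4 * π ^ 2)) N₀ 0 M :=
  fun _ _ _ hL _ _ hn _ Φ hE _ => fibreBoundAt_of_free_minimiser hL hn Φ hE

/-- **THE FREE CASE OF THE CRUX.** The statement of `FibreConductance` with the potential
specialised to `v ≡ 0` (the body of the crux after its first three binders, cf.
`fibreConductance_iff`): for every window parameter `M > 0` there are `ρ₀, C > 0` and `N₀` with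
`FibreConductanceWith ρ₀ C N₀ 0 M` — namely any `ρ₀`, `C = 1/4π²`, any `N₀`. [folklore] -/
theorem fibreConductance_freeCase :
    ∀ M : ℝ, 0 < M → ∃ ρ₀ C : ℝ, 0 < ρ₀ ∧ 0 < C ∧ ∃ N₀ : ℕ, FibreConductanceWith ρ₀ C N₀ 0 M :=
  fun M _ => ⟨1, 1 / (4 * π ^ 2), one_pos, by positivity, 0, fibreConductanceWith_zero 1 M 0⟩

end Summit.AtomisticToContinuum.BoseEinsteinCondensation.Cruxes.FibreConductance.FreeCase

end
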